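/-
Copyright (c) 2026 the pub-hodgecm-mathlib formalisation cell (harness21).  Prover seat hodgecm-mathlib-K2E4-p01 (g0), Track B ∕ K2-LIT (build stream 29),
h413 = `stmt-HodgeConjecture-24833`, line `K2_E4_SingularTransferKappaSign`, socket module «SplitDescent» (U5), file #1 — the REDUCTION of
`K2E4SingularTransferKappaSign.SplitDescent.sig_K2E4ExplicitSplitSingularTransfer` to the two U3 junction sockets (`sig_K2E3GermConstantStableSheets`,
`sig_K2E3GermConstantRegularH`) by linearity.  2026-09-03.
-/
import Literature.NumberTheory.Rogawski1990.TamagawaSingularMembersFinTFCovol   -- ★ the letters' FRAME and κ-block vocabulary (`CanonicalTransferMatrix`, `ArchCanonicalSingularMatrix`, …) — socket frame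
import Literature.NumberTheory.Weil1982.UnitaryFinCentralizerTopFormHaar         -- ★ socket frame import (`UnitaryFinTopForm.finTamagawaPartner`; kept verbatim so the binders elaborate identically)
import Literature.NumberTheory.Rogawski1990.FinExplicitTransferFactorConjLeft     -- ★ `finExplicitDelta_conj_left_all`  (the explicit collection `Δ‴`)
import Literature.NumberTheory.Rogawski1990.FinExplicitTransferFactorConjRight    -- ★ `finExplicitDelta_conj_right_all`
import Literature.NumberTheory.Rogawski1990.ArchCanonicalTransferFactor           -- ★ `archCanonicalTransferFactor` = `Δ‴_∞`
import Literature.NumberTheory.Rogawski1990.ExplicitFactorProductFormula          -- ★ socket frame import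
import Literature.NumberTheory.Automorphic.QuadraticHeckeCharacterCM              -- ★ `quadraticHeckeCharCM` (the μ-GUARD binder)
import Literature.NumberTheory.Rogawski1990.DeltaTransferLinear                   -- ★ `IsLocalDeltaTransfer.add` (+ ★ `IsLocalDeltaTransfer.smul_fun` via `LocalTransferLinear`): transfer pairs form a ℂ-linear relation
import Literature.NumberTheory.Rogawski1990.SingularLocalOrbitSeparation          -- ★ `localStableOrbitalIntegral_add_of_mul_sub_smul_eq_zero` (additivity of `Φ^st(γ₀, ·)` at a singular semisimple `γ₀`)
import Literature.NumberTheory.Rogawski1990.AdelicStableOrbitalEulerDischargeSemisimple  -- ★ `mul_sub_smul_toLocal_toAdelic_eq_zero`, `isUnit_algebraMap_localRing_sub` (`(γ₀)_v` is killed by `(X − e₁)(X − e₂)`)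
import HarnessLib

/-!
# h413 ∕ Track B «K2-LIT», line `K2_E4_SingularTransferKappaSign`, socket «SplitDescent» (U5), file #1 — REDUCTION (helper, `--supports`):
# `sig_K2E4ExplicitSplitSingularTransfer` ⟸ `sig_K2E3GermConstantStableSheets` ∧ `sig_K2E3GermConstantRegularH`, by linearity

Cell `pub/hodgecm-mathlib`, crux H413 = `stmt-HodgeConjecture-24833`, route `HCCMUnconditional`; chair K2-lead (g0), dealer K2E4-plan (g0); EMIT «SKELETON LANDED K2E4»
(REQUESTS l.72384) file #1 (L ①) ↦ seat K2E4-p01.  THEOREMS ONLY (no `def`, no `instance`, no `notation`, no named-fact hypothesis, no `sorry`, default heartbeats);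
imports = ★ Literature + HarnessLib; count-neutral (it does NOT pay socket #1 by name — see WHY).

WHY A REDUCTION.  Socket #1 (the X2♮ letter's ∀-form of [Rogawski1990, Prop. 8.2.1 (a) p. 117] at a place `v` split in `L`) asks for ONE `c_v ≠ 0` with
`Φ^st_{|ω|_v}(γ_{0,v}, f) = c_v · f^H(γ_{H,v})` for EVERY smooth `Δ‴_v`-transfer pair `(f^H, f)`.  With `f := 0` it contains «`f^H ∈ C_c^∞(H_v)` with vanishing stable
orbital integrals at all `G`-regular `γ_H′` ⇒ `f^H(γ_{H,v}) = 0`» at the `H`-CENTRAL `γ_H = (e₁·1₂, e₂)` — Harish-Chandra's density of regular semisimple orbital integrals ∕ the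
non-vanishing of the trivial-orbit Shalika germ on the ELLIPTIC tori of `H_v ≅ GL₂(F) × F^×` ([Rogawski1990, §8.1 p. 116 «`Γ₁^{I(j)} = (−1)^{q(I(j))} d(j)⁻¹` [R₁]»];
[HarishChandra1999AdmissibleDistributions, Thm. 3.1]).  Print's split-case sentence (p. 117 «(a) follows from Lemma 4.13.1») concerns THE descent transfer of Lemma 4.13.1,
not every transfer; the ∀-form's extra content is exactly the U3 junction socket #5 `sig_K2E3GermConstantStableSheets` (OWNER K2E3, stated for ALL `v`), not ★.  This file
proves that nothing ELSE is needed: #1 is #5 ∧ #7 plus ★ linearity — and the split hypothesis `¬ Subsingleton (UnitaryGroup.PlacesOver L v)` is idle in the deduction.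

THE MATHEMATICS.  On the space `V_v` of smooth `Δ‴_v`-transfer pairs — closed under `(p, q, a) ↦ p − a·q` by ★ `IsLocalDeltaTransfer.add` (for `H′` hermitian with
`det H′ ≠ 0`, families admissible on the (`G`-)regular classes: both read off `hCTM`'s ★ `IsLocalTransferDatum` conjunct) and ★ `IsLocalDeltaTransfer.smul_fun` — the functional
`ℓ₁(f) := Φ^st(γ_{0,v}, f; mGs₀_v)` is linear on `C_c` (★ `localStableOrbitalIntegral_add_of_mul_sub_smul_eq_zero`: `(γ₀)_v` is killed by `(X − e₁)(X − e₂)`, `e₁ − e₂` a unit of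
`L ⊗ L⁺_v` — ★ `mul_sub_smul_toLocal_toAdelic_eq_zero`, ★ `isUnit_algebraMap_localRing_sub`; the members of `mGs₀_v` on `𝒪_st((γ₀)_v)` are finite on compacta by the |ω|_v-quotient
clause, ★ `OrbitalMeasureFamily.IsQuotientOf.isAdmissibleOn`, its predicate met by `γ₀` itself, non-regular since `(X − e₁)²(X − e₂)` is not separable; ★ `stableOrbitalIntegralRel_smul_fun`),
`ℓ₂(f^H) := f^H(γ_{H,v})` is evaluation; #5 says `ker ℓ₁ ⊆ ker ℓ₂` on `V_v`, #7 gives `p₀ ∈ V_v` with `ℓ₂(p₀) ≠ 0`, hence `ℓ₁(p₀) ≠ 0`, and `p − (ℓ₁(p)∕ℓ₁(p₀))·p₀ ∈ ker ℓ₁`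
yields `ℓ₁ = c_v · ℓ₂` with `c_v := ℓ₁(p₀)∕ℓ₂(p₀) ≠ 0` (§1 `exists_ne_zero_forall_eq_mul_of_kernel_subset`, frame-free).

* §1 `exists_ne_zero_forall_eq_mul_of_kernel_subset`, `isLocSmooth_const_smul`, `isLocSmooth_sub_const_smul`, `not_isRegularElt_of_charpoly_eq`, `det_ne_zero_of_anisotropic`.
* §2 (the letters' FRAME, ★ p844690 binders byte for byte) **`ExplicitSplitSingularTransfer_of_germSockets`**: hypotheses `h5`, `h7` = the statements of `sig_K2E3GermConstantStableSheets`,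
  `sig_K2E3GermConstantRegularH` (`Cruxes/H413/Lines/K2_E4_SingularTransferKappaSignSigsFinGermConstants.lean`) pasted verbatim UP TO WHITESPACE (re-wrapped); conclusion = the statement of
  `sig_K2E4ExplicitSplitSingularTransfer` (`…SigsSplitDescent.lean`) pasted VERBATIM.  The BY-NAME file `Theorems/K2E4ExplicitSplitSingularTransfer.lean` is then the one-liner
  `ExplicitSplitSingularTransfer_of_germSockets … K2E3GermConstantStableSheets K2E3GermConstantRegularH` once those two Theorems land; the same term pays the non-split twin #3.
NOT HERE: #5 (HC density ∕ germs on `H_v` — OWNER K2E3; at SPLIT `v` it needs a `GL₂(F)`-germ input, not Lemma 4.13.1), #7 (a witness pair), the phase of `c_v` (#2).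
HONEST LABEL.  HC_CM is proved only modulo the 7 printed citations (2 remaining named inputs: hLiu418 = `stmt-HodgeConjecture-24832`, h413 = `stmt-HodgeConjecture-24833`)
until rung 0 closes; this file moves no counter.

## References
* [Rogawski1990] J. D. Rogawski, *Automorphic Representations of Unitary Groups in Three Variables*, Ann. of Math. Stud. 123 (1990): §8.2 Prop. 8.2.1 (a) pp. 117–118;
  §8.1 Prop. 8.1.3 p. 116, (8.1.1)–(8.1.2) p. 117; §4.13 Lemma 4.13.1 p. 70; §4.3 (4.3.1) p. 43; §4.1 (4.1.1) p. 39; §1.6 p. 6; §3.1 p. 19.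
* [HarishChandra1999AdmissibleDistributions] Harish-Chandra (DeBacker–Sally), *Admissible Invariant Distributions on Reductive p-adic Groups*, AMS ULS 16 (1999), Thm. 3.1.
* [Deligne1979ShimuraVarieties] P. Deligne, *Variétés de Shimura*, Corvallis II (1979), Prop. 2.3.10 (anisotropic hermitian forms are non-degenerate).
-/

set_option autoImplicit false
-- the mandated namespace repeats the single-problem summit's segment (`HodgeConjecture.HodgeConjecture`)
set_option linter.dupNamespace false

noncomputable section

open MeasureTheory Measure NumberField IsDedekindDomain
open Literature.MeasureTheory.Group Literature.MeasureTheory.RestrictedProduct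
open Literature.Topology.RestrictedProduct Literature.Topology.Algebra.RestrictedProduct
open Literature.NumberTheory.Rogawski1990 Literature.NumberTheory.Automorphic
open Literature.AlgebraicGeometry.ShimuraVarieties (unitaryGroup hermForm)
open scoped Matrix MatrixGroups RestrictedProduct

namespace Summit.HodgeConjecture.HodgeConjecture.Cruxes.H413.K2E4ExplicitSplitSingularTransferOfGermSockets

/-! ## §1 Frame-free lemmas -/

section Generic

/-- **Two functionals with nested kernels on a linear relation are proportional.**  `P` a relation on pairs `(fH, f)` of functions closed under
`(p, q, a) ↦ p − a • q`, `ℓ₁` additive-homogeneous in `f` along `P`, `ℓ₂` additive-homogeneous in `fH`; if `ℓ₁ f = 0 ⇒ ℓ₂ fH = 0` on `P` and SOME `P`-pair has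
`ℓ₂ fH ≠ 0`, then ONE constant `c ≠ 0` gives `ℓ₁ f = c · ℓ₂ fH` on all of `P` (`c = ℓ₁ f₀ ∕ ℓ₂ fH₀` at the witness).  [cite: Rogawski1990, §8.2 Prop. 8.2.1 (a) p. 117] -/
theorem exists_ne_zero_forall_eq_mul_of_kernel_subset {A B : Type*} (P : (A → ℂ) → (B → ℂ) → Prop) (ℓ₁ : (B → ℂ) → ℂ) (ℓ₂ : (A → ℂ) → ℂ)
    (hP : ∀ (fH gH : A → ℂ) (f g : B → ℂ) (a : ℂ), P fH f → P gH g → P (fH - a • gH) (f - a • g))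
    (hℓ₁ : ∀ (fH gH : A → ℂ) (f g : B → ℂ) (a : ℂ), P fH f → P gH g → ℓ₁ (f - a • g) = ℓ₁ f - a * ℓ₁ g)
    (hℓ₂ : ∀ (fH gH : A → ℂ) (a : ℂ), ℓ₂ (fH - a • gH) = ℓ₂ fH - a * ℓ₂ gH)
    (hker : ∀ (fH : A → ℂ) (f : B → ℂ), P fH f → ℓ₁ f = 0 → ℓ₂ fH = 0)
    (hwit : ∃ (fH : A → ℂ) (f : B → ℂ), P fH f ∧ ℓ₂ fH ≠ 0) :
    ∃ c : ℂ, c ≠ 0 ∧ ∀ (fH : A → ℂ) (f : B → ℂ), P fH f → ℓ₁ f = c * ℓ₂ fH := by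
  obtain ⟨fH₀, f₀, hP₀, h₂₀⟩ := hwit
  have h₁₀ : ℓ₁ f₀ ≠ 0 := fun h => h₂₀ (hker fH₀ f₀ hP₀ h)
  refine ⟨ℓ₁ f₀ / ℓ₂ fH₀, div_ne_zero h₁₀ h₂₀, fun fH f hPf => ?_⟩
  set a : ℂ := ℓ₁ f / ℓ₁ f₀ with ha
  have hq : P (fH - a • fH₀) (f - a • f₀) := hP fH fH₀ f f₀ a hPf hP₀
  have h1 : ℓ₁ (f - a • f₀) = 0 := by
    rw [hℓ₁ fH fH₀ f f₀ a hPf hP₀, ha, div_mul_cancel₀ _ h₁₀, sub_self]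
  have h2 : ℓ₂ fH = a * ℓ₂ fH₀ := by
    have h := hker _ _ hq h1
    rw [hℓ₂] at h
    exact sub_eq_zero.1 h
  rw [h2, ha]
  field_simp

variable {X : Type*} [TopologicalSpace X]

/-- `a • φ ∈ C_c^∞` for `φ ∈ C_c^∞` (locally constant with compact support). [cite: Rogawski1990, §1.6 p. 6] -/
theorem isLocSmooth_const_smul (a : ℂ) {φ : X → ℂ} (hφ : IsLocSmooth φ) : IsLocSmooth (a • φ) :=
  ⟨hφ.1.comp fun y => a • y, hφ.2.smul_left (f := fun _ : X => a)⟩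

/-- `φ − a • ψ ∈ C_c^∞` for `φ, ψ ∈ C_c^∞`. [cite: Rogawski1990, §1.6 p. 6] -/
theorem isLocSmooth_sub_const_smul (a : ℂ) {φ ψ : X → ℂ} (hφ : IsLocSmooth φ) (hψ : IsLocSmooth ψ) : IsLocSmooth (φ - a • ψ) := by
  rw [sub_eq_add_neg, ← neg_smul]
  exact hφ.add (isLocSmooth_const_smul (-a) hψ)

/-- **`(X − e₁)²(X − e₂)` is not separable**: an element of `GL₃` with this characteristic polynomial is NOT regular semisimple (★ `IsRegularElt`).
[cite: Rogawski1990, §3.1 p. 19; §8.2 p. 117] -/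
theorem not_isRegularElt_of_charpoly_eq {R : Type*} [CommRing R] [Nontrivial R] {n : Type*} [Fintype n] [DecidableEq n] (g : GL n R) (e₁ e₂ : R)
    (h : (g : Matrix n n R).charpoly = (Polynomial.X - Polynomial.C e₁) ^ 2 * (Polynomial.X - Polynomial.C e₂)) : ¬ IsRegularElt g := by
  intro hreg
  rw [isRegularElt_iff, h] at hreg
  have hsq := (hreg.of_mul_left).squarefree
  exact Polynomial.not_isUnit_X_sub_C e₁ (hsq (Polynomial.X - Polynomial.C e₁) (dvd_of_eq (pow_two _).symm))

/-- `H′` anisotropic ⟹ `det H′ ≠ 0` (a kernel vector is isotropic; Mathlib `Matrix.exists_mulVec_eq_zero_iff`). [cite: Deligne1979ShimuraVarieties, Prop. 2.3.10] -/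
theorem det_ne_zero_of_anisotropic {L : Type} [Field L] [NumberField L] [IsCMField L] {H : Matrix (Fin 3) (Fin 3) L}
    (hH0 : ∀ x : Fin 3 → L, hermForm (cmConjRingHom L) H x x = 0 → x = 0) : H.det ≠ 0 := by
  intro hdet
  obtain ⟨x, hx, hHx⟩ := Matrix.exists_mulVec_eq_zero_iff.mpr hdet
  refine hx (hH0 x ?_)
  rw [hermForm, hHx, dotProduct_zero]

end Generic

/-! ## §2 The reduction under the letters' frame -/

section Frame
variable (L : Type) [Field L] [NumberField L] [IsCMField L]

variable (H' : Matrix (Fin 3) (Fin 3) L) (Tinf : ArchTransferFactor L H')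
    -- σ-algebras of the `G′` side (★ (O10-c5) block), of `H_v`, `G_∞`, `H_∞`, and the Haar data — EXACTLY ★ `SingularEllipticTransfer`'s binders
    [∀ g : (UnitaryGroup.cmDatum L 3 H').Adelic, MeasurableSpace ((UnitaryGroup.cmDatum L 3 H').Adelic ⧸ Subgroup.centralizer ({g} : Set (UnitaryGroup.cmDatum L 3 H').Adelic))]
    [∀ g : (UnitaryGroup.cmDatum L 3 H').Adelic, BorelSpace ((UnitaryGroup.cmDatum L 3 H').Adelic ⧸ Subgroup.centralizer ({g} : Set (UnitaryGroup.cmDatum L 3 H').Adelic))]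
    [∀ γ : UnitaryGroup.arch (↥(maximalRealSubfield L)) L (IsCMField.complexConj L) 3 H',
      MeasurableSpace (UnitaryGroup.arch (↥(maximalRealSubfield L)) L (IsCMField.complexConj L) 3 H' ⧸ Subgroup.centralizer ({γ} : Set (UnitaryGroup.arch (↥(maximalRealSubfield L)) L (IsCMField.complexConj L) 3 H')))]
    [∀ γ : UnitaryGroup.arch (↥(maximalRealSubfield L)) L (IsCMField.complexConj L) 3 H',
      BorelSpace (UnitaryGroup.arch (↥(maximalRealSubfield L)) L (IsCMField.complexConj L) 3 H' ⧸ Subgroup.centralizer ({γ} : Set (UnitaryGroup.arch (↥(maximalRealSubfield L)) L (IsCMField.complexConj L) 3 H')))]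
    [∀ (v : HeightOneSpectrum (𝓞 ↥(maximalRealSubfield L))) (γ : (UnitaryGroup.cmDatum L 3 H').Local v),
      MeasurableSpace ((UnitaryGroup.cmDatum L 3 H').Local v ⧸ Subgroup.centralizer ({γ} : Set ((UnitaryGroup.cmDatum L 3 H').Local v)))]
    [∀ (v : HeightOneSpectrum (𝓞 ↥(maximalRealSubfield L))) (γ : (UnitaryGroup.cmDatum L 3 H').Local v),
      BorelSpace ((UnitaryGroup.cmDatum L 3 H').Local v ⧸ Subgroup.centralizer ({γ} : Set ((UnitaryGroup.cmDatum L 3 H').Local v)))]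
    [∀ v : HeightOneSpectrum (𝓞 ↥(maximalRealSubfield L)), MeasurableSpace ((UnitaryGroup.cmDatum L 3 H').Local v)] [∀ v : HeightOneSpectrum (𝓞 ↥(maximalRealSubfield L)), BorelSpace ((UnitaryGroup.cmDatum L 3 H').Local v)]
    [MeasurableSpace (UnitaryGroup.cmDatum L 3 H').Adelic] [BorelSpace (UnitaryGroup.cmDatum L 3 H').Adelic]
    [MeasurableSpace (UnitaryGroup.arch (↥(maximalRealSubfield L)) L (IsCMField.complexConj L) 3 H')] [BorelSpace (UnitaryGroup.arch (↥(maximalRealSubfield L)) L (IsCMField.complexConj L) 3 H')]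
    [∀ γ : (UnitaryGroup.cmDatum L 3 H').Adelic, MeasurableSpace (↥(Subgroup.centralizer ({γ} : Set (UnitaryGroup.cmDatum L 3 H').Adelic)) ⧸
      ((UnitaryGroup.cmDatum L 3 H').quotientSubgroup ⊓ Subgroup.centralizer ({γ} : Set (UnitaryGroup.cmDatum L 3 H').Adelic)).subgroupOf (Subgroup.centralizer ({γ} : Set (UnitaryGroup.cmDatum L 3 H').Adelic)))]
    [∀ γ : (UnitaryGroup.cmDatum L 3 H').Adelic, BorelSpace (↥(Subgroup.centralizer ({γ} : Set (UnitaryGroup.cmDatum L 3 H').Adelic)) ⧸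
      ((UnitaryGroup.cmDatum L 3 H').quotientSubgroup ⊓ Subgroup.centralizer ({γ} : Set (UnitaryGroup.cmDatum L 3 H').Adelic)).subgroupOf (Subgroup.centralizer ({γ} : Set (UnitaryGroup.cmDatum L 3 H').Adelic)))]
    [hCcl : ∀ γ : (UnitaryGroup.cmDatum L 3 H').Adelic, IsClosed ((Subgroup.centralizer ({γ} : Set (UnitaryGroup.cmDatum L 3 H').Adelic) : Subgroup (UnitaryGroup.cmDatum L 3 H').Adelic) : Set (UnitaryGroup.cmDatum L 3 H').Adelic)]
    [∀ γ : (UnitaryGroup.cmDatum L 3 H').Adelic, (count : Measure ↥(((UnitaryGroup.cmDatum L 3 H').quotientSubgroup ⊓ Subgroup.centralizer ({γ} : Set (UnitaryGroup.cmDatum L 3 H').Adelic)).subgroupOf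
      (Subgroup.centralizer ({γ} : Set (UnitaryGroup.cmDatum L 3 H').Adelic)))).IsHaarMeasure]
    [∀ v : HeightOneSpectrum (𝓞 ↥(maximalRealSubfield L)), MeasurableSpace ((UnitaryGroup.cmDatum L 2 (Matrix.of fun i j : Fin 2 => if i.val + j.val + 1 = 2 then (1 : L) else 0)).Local v ×
        (UnitaryGroup.cmDatum L 1 (Matrix.of fun i j : Fin 1 => if i.val + j.val + 1 = 1 then (1 : L) else 0)).Local v)]
    [∀ v : HeightOneSpectrum (𝓞 ↥(maximalRealSubfield L)), BorelSpace ((UnitaryGroup.cmDatum L 2 (Matrix.of fun i j : Fin 2 => if i.val + j.val + 1 = 2 then (1 : L) else 0)).Local v ×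
        (UnitaryGroup.cmDatum L 1 (Matrix.of fun i j : Fin 1 => if i.val + j.val + 1 = 1 then (1 : L) else 0)).Local v)]
    [∀ (v : HeightOneSpectrum (𝓞 ↥(maximalRealSubfield L))) (a : ((UnitaryGroup.cmDatum L 2 (Matrix.of fun i j : Fin 2 => if i.val + j.val + 1 = 2 then (1 : L) else 0)).Local v ×
        (UnitaryGroup.cmDatum L 1 (Matrix.of fun i j : Fin 1 => if i.val + j.val + 1 = 1 then (1 : L) else 0)).Local v)),
      MeasurableSpace (((UnitaryGroup.cmDatum L 2 (Matrix.of fun i j : Fin 2 => if i.val + j.val + 1 = 2 then (1 : L) else 0)).Local v ×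
        (UnitaryGroup.cmDatum L 1 (Matrix.of fun i j : Fin 1 => if i.val + j.val + 1 = 1 then (1 : L) else 0)).Local v) ⧸ Subgroup.centralizer ({a} : Set ((UnitaryGroup.cmDatum L 2 (Matrix.of fun i j : Fin 2 => if i.val + j.val + 1 = 2 then (1 : L) else 0)).Local v ×
        (UnitaryGroup.cmDatum L 1 (Matrix.of fun i j : Fin 1 => if i.val + j.val + 1 = 1 then (1 : L) else 0)).Local v)))]
    [∀ (v : HeightOneSpectrum (𝓞 ↥(maximalRealSubfield L))) (a : ((UnitaryGroup.cmDatum L 2 (Matrix.of fun i j : Fin 2 => if i.val + j.val + 1 = 2 then (1 : L) else 0)).Local v ×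
        (UnitaryGroup.cmDatum L 1 (Matrix.of fun i j : Fin 1 => if i.val + j.val + 1 = 1 then (1 : L) else 0)).Local v)),
      BorelSpace (((UnitaryGroup.cmDatum L 2 (Matrix.of fun i j : Fin 2 => if i.val + j.val + 1 = 2 then (1 : L) else 0)).Local v ×
        (UnitaryGroup.cmDatum L 1 (Matrix.of fun i j : Fin 1 => if i.val + j.val + 1 = 1 then (1 : L) else 0)).Local v) ⧸ Subgroup.centralizer ({a} : Set ((UnitaryGroup.cmDatum L 2 (Matrix.of fun i j : Fin 2 => if i.val + j.val + 1 = 2 then (1 : L) else 0)).Local v ×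
        (UnitaryGroup.cmDatum L 1 (Matrix.of fun i j : Fin 1 => if i.val + j.val + 1 = 1 then (1 : L) else 0)).Local v)))]
    [MeasurableSpace (UnitaryGroup.arch (↥(maximalRealSubfield L)) L (IsCMField.complexConj L) 3 (Matrix.of fun i j : Fin 3 => if i.val + j.val + 1 = 3 then (1 : L) else 0))] [BorelSpace (UnitaryGroup.arch (↥(maximalRealSubfield L)) L (IsCMField.complexConj L) 3 (Matrix.of fun i j : Fin 3 => if i.val + j.val + 1 = 3 then (1 : L) else 0))]
    [∀ γ : UnitaryGroup.arch (↥(maximalRealSubfield L)) L (IsCMField.complexConj L) 3 (Matrix.of fun i j : Fin 3 => if i.val + j.val + 1 = 3 then (1 : L) else 0),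
      MeasurableSpace (UnitaryGroup.arch (↥(maximalRealSubfield L)) L (IsCMField.complexConj L) 3 (Matrix.of fun i j : Fin 3 => if i.val + j.val + 1 = 3 then (1 : L) else 0) ⧸ Subgroup.centralizer ({γ} : Set (UnitaryGroup.arch (↥(maximalRealSubfield L)) L (IsCMField.complexConj L) 3 (Matrix.of fun i j : Fin 3 => if i.val + j.val + 1 = 3 then (1 : L) else 0))))]
    [∀ γ : UnitaryGroup.arch (↥(maximalRealSubfield L)) L (IsCMField.complexConj L) 3 (Matrix.of fun i j : Fin 3 => if i.val + j.val + 1 = 3 then (1 : L) else 0),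
      BorelSpace (UnitaryGroup.arch (↥(maximalRealSubfield L)) L (IsCMField.complexConj L) 3 (Matrix.of fun i j : Fin 3 => if i.val + j.val + 1 = 3 then (1 : L) else 0) ⧸ Subgroup.centralizer ({γ} : Set (UnitaryGroup.arch (↥(maximalRealSubfield L)) L (IsCMField.complexConj L) 3 (Matrix.of fun i j : Fin 3 => if i.val + j.val + 1 = 3 then (1 : L) else 0))))]
    [MeasurableSpace (UnitaryGroup.arch (↥(maximalRealSubfield L)) L (IsCMField.complexConj L) 2 (Matrix.of fun i j : Fin 2 => if i.val + j.val + 1 = 2 then (1 : L) else 0) ×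
          UnitaryGroup.arch (↥(maximalRealSubfield L)) L (IsCMField.complexConj L) 1 (Matrix.of fun i j : Fin 1 => if i.val + j.val + 1 = 1 then (1 : L) else 0))]
    [BorelSpace (UnitaryGroup.arch (↥(maximalRealSubfield L)) L (IsCMField.complexConj L) 2 (Matrix.of fun i j : Fin 2 => if i.val + j.val + 1 = 2 then (1 : L) else 0) ×
          UnitaryGroup.arch (↥(maximalRealSubfield L)) L (IsCMField.complexConj L) 1 (Matrix.of fun i j : Fin 1 => if i.val + j.val + 1 = 1 then (1 : L) else 0))]
    [∀ a : (UnitaryGroup.arch (↥(maximalRealSubfield L)) L (IsCMField.complexConj L) 2 (Matrix.of fun i j : Fin 2 => if i.val + j.val + 1 = 2 then (1 : L) else 0) ×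
          UnitaryGroup.arch (↥(maximalRealSubfield L)) L (IsCMField.complexConj L) 1 (Matrix.of fun i j : Fin 1 => if i.val + j.val + 1 = 1 then (1 : L) else 0)),
      MeasurableSpace ((UnitaryGroup.arch (↥(maximalRealSubfield L)) L (IsCMField.complexConj L) 2 (Matrix.of fun i j : Fin 2 => if i.val + j.val + 1 = 2 then (1 : L) else 0) ×
          UnitaryGroup.arch (↥(maximalRealSubfield L)) L (IsCMField.complexConj L) 1 (Matrix.of fun i j : Fin 1 => if i.val + j.val + 1 = 1 then (1 : L) else 0)) ⧸ Subgroup.centralizer ({a} : Set (UnitaryGroup.arch (↥(maximalRealSubfield L)) L (IsCMField.complexConj L) 2 (Matrix.of fun i j : Fin 2 => if i.val + j.val + 1 = 2 then (1 : L) else 0) ×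
          UnitaryGroup.arch (↥(maximalRealSubfield L)) L (IsCMField.complexConj L) 1 (Matrix.of fun i j : Fin 1 => if i.val + j.val + 1 = 1 then (1 : L) else 0))))]
    [∀ a : (UnitaryGroup.arch (↥(maximalRealSubfield L)) L (IsCMField.complexConj L) 2 (Matrix.of fun i j : Fin 2 => if i.val + j.val + 1 = 2 then (1 : L) else 0) ×
          UnitaryGroup.arch (↥(maximalRealSubfield L)) L (IsCMField.complexConj L) 1 (Matrix.of fun i j : Fin 1 => if i.val + j.val + 1 = 1 then (1 : L) else 0)),
      BorelSpace ((UnitaryGroup.arch (↥(maximalRealSubfield L)) L (IsCMField.complexConj L) 2 (Matrix.of fun i j : Fin 2 => if i.val + j.val + 1 = 2 then (1 : L) else 0) ×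
          UnitaryGroup.arch (↥(maximalRealSubfield L)) L (IsCMField.complexConj L) 1 (Matrix.of fun i j : Fin 1 => if i.val + j.val + 1 = 1 then (1 : L) else 0)) ⧸ Subgroup.centralizer ({a} : Set (UnitaryGroup.arch (↥(maximalRealSubfield L)) L (IsCMField.complexConj L) 2 (Matrix.of fun i j : Fin 2 => if i.val + j.val + 1 = 2 then (1 : L) else 0) ×
          UnitaryGroup.arch (↥(maximalRealSubfield L)) L (IsCMField.complexConj L) 1 (Matrix.of fun i j : Fin 1 => if i.val + j.val + 1 = 1 then (1 : L) else 0))))]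
    (νH : ∀ v : HeightOneSpectrum (𝓞 ↥(maximalRealSubfield L)), Measure ((UnitaryGroup.cmDatum L 2 (Matrix.of fun i j : Fin 2 => if i.val + j.val + 1 = 2 then (1 : L) else 0)).Local v ×
        (UnitaryGroup.cmDatum L 1 (Matrix.of fun i j : Fin 1 => if i.val + j.val + 1 = 1 then (1 : L) else 0)).Local v))
    (νG : ∀ v : HeightOneSpectrum (𝓞 ↥(maximalRealSubfield L)), Measure ((UnitaryGroup.cmDatum L 3 H').Local v))
    [∀ v, IsFiniteMeasureOnCompacts (νH v)] [∀ v, (νH v).IsMulRightInvariant]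
    [∀ v, (νG v).IsHaarMeasure] [∀ v, (νG v).IsMulRightInvariant]  -- MAIN-b's strength (F2): `νG_v` Haar
    (νGi : Measure (UnitaryGroup.arch (↥(maximalRealSubfield L)) L (IsCMField.complexConj L) 3 H')) (νqi : Measure (UnitaryGroup.arch (↥(maximalRealSubfield L)) L (IsCMField.complexConj L) 3 (Matrix.of fun i j : Fin 3 => if i.val + j.val + 1 = 3 then (1 : L) else 0)))
    (νHi : Measure (UnitaryGroup.arch (↥(maximalRealSubfield L)) L (IsCMField.complexConj L) 2 (Matrix.of fun i j : Fin 2 => if i.val + j.val + 1 = 2 then (1 : L) else 0) ×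
          UnitaryGroup.arch (↥(maximalRealSubfield L)) L (IsCMField.complexConj L) 1 (Matrix.of fun i j : Fin 1 => if i.val + j.val + 1 = 1 then (1 : L) else 0)))
    [IsFiniteMeasureOnCompacts νGi] [νGi.IsMulRightInvariant] [IsFiniteMeasureOnCompacts νqi] [νqi.IsMulRightInvariant]
    [IsFiniteMeasureOnCompacts νHi] [νHi.IsMulRightInvariant]

-- three of the frame's measure-theoretic instance binders and several value binders are auto-bound in the pasted types (bytes frozen) but not read by the deduction
set_option linter.unusedSectionVars false in
/-- **Socket #1 `sig_K2E4ExplicitSplitSingularTransfer` of `Cruxes/H413/Lines/K2_E4_SingularTransferKappaSignSigsSplitDescent.lean` FROM the U3 junction sockets #5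
`sig_K2E3GermConstantStableSheets` (`h5`) and #7 `sig_K2E3GermConstantRegularH` (`h7`) of `…SigsFinGermConstants.lean` (the two hypotheses pasted up to whitespace, the conclusion byte for byte).**
For the pinned explicit data and the |ω|_v-Tamagawa quotient family `mGs₀`, at the semiregular pair `(γ_H, γ₀)` and EVERY finite `v` (the split hypothesis is carried, unused):
ONE `c_v ≠ 0` with `Φ^st(γ_{0,v}, f) = c_v · f^H(γ_{H,v})` for all smooth `Δ‴_v`-transfer pairs.  Proof: §1 `exists_ne_zero_forall_eq_mul_of_kernel_subset` on the relation
«`f`, `f^H` smooth and `f → f^H`» with `ℓ₁ = Φ^st(γ_{0,v}, ·; mGs₀_v)`, `ℓ₂ = ev_{γ_{H,v}}`: closure by ★ `IsLocalDeltaTransfer.add` ∕ ★ `.smul_fun` (admissibility and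
`det H′ ≠ 0` from `hCTM`, `hanis`), linearity of `ℓ₁` by ★ `localStableOrbitalIntegral_add_of_mul_sub_smul_eq_zero` (`(γ₀)_v` killed by `(X − e₁)(X − e₂)`, ★
`mul_sub_smul_toLocal_toAdelic_eq_zero`; finiteness on compacta of `mGs₀_v` on `𝒪_st((γ₀)_v)` from the quotient clause, ★ `IsQuotientOf.isAdmissibleOn`, at the witness `γ₀`,
non-regular by `not_isRegularElt_of_charpoly_eq`) and ★ `stableOrbitalIntegralRel_smul_fun`; kernel inclusion = `h5`, witness = `h7`.
[cite: Rogawski1990, §8.2 Prop. 8.2.1 (a) p. 117; §8.1 Prop. 8.1.3 p. 116; §4.13 Lemma 4.13.1 p. 70; §4.1 (4.1.1) p. 39] [cite: HarishChandra1999AdmissibleDistributions, Thm. 3.1] -/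
theorem ExplicitSplitSingularTransfer_of_germSockets
    (h5 :
      ∀ (hK : ∀ v : HeightOneSpectrum (𝓞 ↥(maximalRealSubfield L)), νG v (UnitaryGroup.cmLocalIntegralLevel L 3 H' v : Set ((UnitaryGroup.cmDatum L 3 H').Local v)) = 1) (hanis : ∀ x : Fin 3 → L, hermForm (cmConjRingHom L) H' x x = 0 →
        x = 0) (Sbad : Finset (HeightOneSpectrum (𝓞 ↥(maximalRealSubfield L)))) (Δ : ∀ v : HeightOneSpectrum (𝓞 ↥(maximalRealSubfield L)), LocalTransferFactor L H' v) (mH : ∀ v : HeightOneSpectrum (𝓞 ↥(maximalRealSubfield L)),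
        OrbitalMeasureFamily ((UnitaryGroup.cmDatum L 2 (Matrix.of fun i j : Fin 2 => if i.val + j.val + 1 = 2 then (1 : L) else 0)).Local v × (UnitaryGroup.cmDatum L 1 (Matrix.of fun i j : Fin 1 => if i.val + j.val + 1 = 1 then (1 :
        L) else 0)).Local v)) (mG : ∀ v : HeightOneSpectrum (𝓞 ↥(maximalRealSubfield L)), OrbitalMeasureFamily ((UnitaryGroup.cmDatum L 3 H').Local v)) (m' : OrbitalMeasureFamily (UnitaryGroup.arch (↥(maximalRealSubfield L)) L
        (IsCMField.complexConj L) 3 H')) (m : OrbitalMeasureFamily (UnitaryGroup.arch (↥(maximalRealSubfield L)) L (IsCMField.complexConj L) 3 (Matrix.of fun i j : Fin 3 => if i.val + j.val + 1 = 3 then (1 : L) else 0))) (mHi :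
        OrbitalMeasureFamily (UnitaryGroup.arch (↥(maximalRealSubfield L)) L (IsCMField.complexConj L) 2 (Matrix.of fun i j : Fin 2 => if i.val + j.val + 1 = 2 then (1 : L) else 0) × UnitaryGroup.arch (↥(maximalRealSubfield L)) L
        (IsCMField.complexConj L) 1 (Matrix.of fun i j : Fin 1 => if i.val + j.val + 1 = 1 then (1 : L) else 0))) (t' : ∀ γ' : UnitaryGroup.arch (↥(maximalRealSubfield L)) L (IsCMField.complexConj L) 3 H', Measure (Subgroup.centralizer
        ({γ'} : Set (UnitaryGroup.arch (↥(maximalRealSubfield L)) L (IsCMField.complexConj L) 3 H')))) (t : ∀ γ : UnitaryGroup.arch (↥(maximalRealSubfield L)) L (IsCMField.complexConj L) 3 (Matrix.of fun i j : Fin 3 => if i.val + j.val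
        + 1 = 3 then (1 : L) else 0), Measure (Subgroup.centralizer ({γ} : Set (UnitaryGroup.arch (↥(maximalRealSubfield L)) L (IsCMField.complexConj L) 3 (Matrix.of fun i j : Fin 3 => if i.val + j.val + 1 = 3 then (1 : L) else 0)))))
        (tH : ∀ γH : UnitaryGroup.arch (↥(maximalRealSubfield L)) L (IsCMField.complexConj L) 2 (Matrix.of fun i j : Fin 2 => if i.val + j.val + 1 = 2 then (1 : L) else 0) × UnitaryGroup.arch (↥(maximalRealSubfield L)) L
        (IsCMField.complexConj L) 1 (Matrix.of fun i j : Fin 1 => if i.val + j.val + 1 = 1 then (1 : L) else 0), Measure (Subgroup.centralizer ({γH} : Set (UnitaryGroup.arch (↥(maximalRealSubfield L)) L (IsCMField.complexConj L) 2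
        (Matrix.of fun i j : Fin 2 => if i.val + j.val + 1 = 2 then (1 : L) else 0) × UnitaryGroup.arch (↥(maximalRealSubfield L)) L (IsCMField.complexConj L) 1 (Matrix.of fun i j : Fin 1 => if i.val + j.val + 1 = 1 then (1 : L) else
        0))))) (hherm : (H'.map (cmConjRingHom L)).transpose = H') (hCTM : CanonicalTransferMatrix L H' Tinf.Δ νH νG Sbad Δ mH mG) (hACS : ArchCanonicalSingularMatrix L H' Tinf νGi νqi νHi hanis m' m mHi t' t tH), ∀ (μ :
        Literature.NumberTheory.GaloisRepresentations.HeckeCharacter L) (hμu : μ.IsUnitary) (hμω : ∀ x : Literature.NumberTheory.GaloisRepresentations.ideleGroup ↥(maximalRealSubfield L), μ (AdeleRing.ideleBaseChange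
        (↥(maximalRealSubfield L)) L x) = quadraticHeckeCharCM L x) (hΔ : Δ = finExplicitCollection L H' μ (finExplicitDelta_conj_left_all L H' μ) (finExplicitDelta_conj_right_all L H' μ)) (hTinf : Tinf = archCanonicalTransferFactor L
        H' μ), ∀ (mGs₀ : ∀ v : HeightOneSpectrum (𝓞 ↥(maximalRealSubfield L)), OrbitalMeasureFamily ((UnitaryGroup.cmDatum L 3 H').Local v)), (∀ v, (mGs₀ v).IsQuotientOf (fun x : (UnitaryGroup.cmDatum L 3 H').Local v => ∃ γ₀ :
        (UnitaryGroup.cmDatum L 3 H').Rational, ¬ IsRegularElt (γ₀.val : GL (Fin 3) L) ∧ Corresponds (UnitaryGroup.conjLocal L (IsCMField.complexConj L) v) ((UnitaryGroup.adelicForm L 3 H').map (UnitaryGroup.adeleToLocal L v))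
        ((UnitaryGroup.adelicForm L 3 H').map (UnitaryGroup.adeleToLocal L v)) ((UnitaryGroup.cmDatum L 3 H').toLocal v ((UnitaryGroup.cmDatum L 3 H').toAdelic γ₀)) x) (νG v)
        (Literature.NumberTheory.Weil1982.UnitaryFinTopForm.finTamagawaPartner L 3 H' v)) → ∀ (γ₀ : (UnitaryGroup.cmDatum L 3 H').Rational) (e₁ e₂ : L), e₁ ≠ e₂ → ((((γ₀ : unitaryGroup (cmConjRingHom L) H').val : GL (Fin 3) L) : Matrix
        (Fin 3) (Fin 3) L) - e₁ • (1 : Matrix (Fin 3) (Fin 3) L)) * ((((γ₀ : unitaryGroup (cmConjRingHom L) H').val : GL (Fin 3) L) : Matrix (Fin 3) (Fin 3) L) - e₂ • (1 : Matrix (Fin 3) (Fin 3) L)) = 0 → (¬ ∃ ζ : L, (((γ₀ :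
        unitaryGroup (cmConjRingHom L) H').val : GL (Fin 3) L) : Matrix (Fin 3) (Fin 3) L) = ζ • (1 : Matrix (Fin 3) (Fin 3) L)) → (((γ₀ : unitaryGroup (cmConjRingHom L) H').val : GL (Fin 3) L) : Matrix (Fin 3) (Fin 3) L).charpoly =
        (Polynomial.X - Polynomial.C e₁) ^ 2 * (Polynomial.X - Polynomial.C e₂) → ∀ (γH : (UnitaryGroup.cmDatum L 2 (Matrix.of fun i j : Fin 2 => if i.val + j.val + 1 = 2 then (1 : L) else 0)).Rational × (UnitaryGroup.cmDatum L 1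
        (Matrix.of fun i j : Fin 1 => if i.val + j.val + 1 = 1 then (1 : L) else 0)).Rational), (((γH.1 : unitaryGroup (cmConjRingHom L) (Matrix.of fun i j : Fin 2 => if i.val + j.val + 1 = 2 then (1 : L) else 0)).val : GL (Fin 2) L) :
        Matrix (Fin 2) (Fin 2) L) = e₁ • (1 : Matrix (Fin 2) (Fin 2) L) → (((γH.2 : unitaryGroup (cmConjRingHom L) (Matrix.of fun i j : Fin 1 => if i.val + j.val + 1 = 1 then (1 : L) else 0)).val : GL (Fin 1) L) : Matrix (Fin 1) (Fin
        1) L) 0 0 = e₂ → ∀ (v : HeightOneSpectrum (𝓞 ↥(maximalRealSubfield L))) (fH : (UnitaryGroup.cmDatum L 2 (Matrix.of fun i j : Fin 2 => if i.val + j.val + 1 = 2 then (1 : L) else 0)).Local v × (UnitaryGroup.cmDatum L 1 (Matrix.of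
        fun i j : Fin 1 => if i.val + j.val + 1 = 1 then (1 : L) else 0)).Local v → ℂ) (f : (UnitaryGroup.cmDatum L 3 H').Local v → ℂ), IsLocSmooth f → IsLocSmooth fH → IsLocalDeltaTransfer L H' v (Δ v) (mH v) (mG v) fH f →
        localStableOrbitalIntegral L 3 H' v (mGs₀ v) f ((UnitaryGroup.cmDatum L 3 H').toLocal v ((UnitaryGroup.cmDatum L 3 H').toAdelic γ₀)) = 0 → fH ((UnitaryGroup.cmDatum L 2 (Matrix.of fun i j : Fin 2 => if i.val + j.val + 1 = 2
        then (1 : L) else 0)).toLocal v ((UnitaryGroup.cmDatum L 2 (Matrix.of fun i j : Fin 2 => if i.val + j.val + 1 = 2 then (1 : L) else 0)).toAdelic γH.1), (UnitaryGroup.cmDatum L 1 (Matrix.of fun i j : Fin 1 => if i.val + j.val +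
        1 = 1 then (1 : L) else 0)).toLocal v ((UnitaryGroup.cmDatum L 1 (Matrix.of fun i j : Fin 1 => if i.val + j.val + 1 = 1 then (1 : L) else 0)).toAdelic γH.2)) = 0)
    (h7 :
      ∀ (hK : ∀ v : HeightOneSpectrum (𝓞 ↥(maximalRealSubfield L)), νG v (UnitaryGroup.cmLocalIntegralLevel L 3 H' v : Set ((UnitaryGroup.cmDatum L 3 H').Local v)) = 1) (hanis : ∀ x : Fin 3 → L, hermForm (cmConjRingHom L) H' x x = 0 →
        x = 0) (Sbad : Finset (HeightOneSpectrum (𝓞 ↥(maximalRealSubfield L)))) (Δ : ∀ v : HeightOneSpectrum (𝓞 ↥(maximalRealSubfield L)), LocalTransferFactor L H' v) (mH : ∀ v : HeightOneSpectrum (𝓞 ↥(maximalRealSubfield L)),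
        OrbitalMeasureFamily ((UnitaryGroup.cmDatum L 2 (Matrix.of fun i j : Fin 2 => if i.val + j.val + 1 = 2 then (1 : L) else 0)).Local v × (UnitaryGroup.cmDatum L 1 (Matrix.of fun i j : Fin 1 => if i.val + j.val + 1 = 1 then (1 :
        L) else 0)).Local v)) (mG : ∀ v : HeightOneSpectrum (𝓞 ↥(maximalRealSubfield L)), OrbitalMeasureFamily ((UnitaryGroup.cmDatum L 3 H').Local v)) (m' : OrbitalMeasureFamily (UnitaryGroup.arch (↥(maximalRealSubfield L)) L
        (IsCMField.complexConj L) 3 H')) (m : OrbitalMeasureFamily (UnitaryGroup.arch (↥(maximalRealSubfield L)) L (IsCMField.complexConj L) 3 (Matrix.of fun i j : Fin 3 => if i.val + j.val + 1 = 3 then (1 : L) else 0))) (mHi :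
        OrbitalMeasureFamily (UnitaryGroup.arch (↥(maximalRealSubfield L)) L (IsCMField.complexConj L) 2 (Matrix.of fun i j : Fin 2 => if i.val + j.val + 1 = 2 then (1 : L) else 0) × UnitaryGroup.arch (↥(maximalRealSubfield L)) L
        (IsCMField.complexConj L) 1 (Matrix.of fun i j : Fin 1 => if i.val + j.val + 1 = 1 then (1 : L) else 0))) (t' : ∀ γ' : UnitaryGroup.arch (↥(maximalRealSubfield L)) L (IsCMField.complexConj L) 3 H', Measure (Subgroup.centralizer
        ({γ'} : Set (UnitaryGroup.arch (↥(maximalRealSubfield L)) L (IsCMField.complexConj L) 3 H')))) (t : ∀ γ : UnitaryGroup.arch (↥(maximalRealSubfield L)) L (IsCMField.complexConj L) 3 (Matrix.of fun i j : Fin 3 => if i.val + j.val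
        + 1 = 3 then (1 : L) else 0), Measure (Subgroup.centralizer ({γ} : Set (UnitaryGroup.arch (↥(maximalRealSubfield L)) L (IsCMField.complexConj L) 3 (Matrix.of fun i j : Fin 3 => if i.val + j.val + 1 = 3 then (1 : L) else 0)))))
        (tH : ∀ γH : UnitaryGroup.arch (↥(maximalRealSubfield L)) L (IsCMField.complexConj L) 2 (Matrix.of fun i j : Fin 2 => if i.val + j.val + 1 = 2 then (1 : L) else 0) × UnitaryGroup.arch (↥(maximalRealSubfield L)) L
        (IsCMField.complexConj L) 1 (Matrix.of fun i j : Fin 1 => if i.val + j.val + 1 = 1 then (1 : L) else 0), Measure (Subgroup.centralizer ({γH} : Set (UnitaryGroup.arch (↥(maximalRealSubfield L)) L (IsCMField.complexConj L) 2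
        (Matrix.of fun i j : Fin 2 => if i.val + j.val + 1 = 2 then (1 : L) else 0) × UnitaryGroup.arch (↥(maximalRealSubfield L)) L (IsCMField.complexConj L) 1 (Matrix.of fun i j : Fin 1 => if i.val + j.val + 1 = 1 then (1 : L) else
        0))))) (hherm : (H'.map (cmConjRingHom L)).transpose = H') (hCTM : CanonicalTransferMatrix L H' Tinf.Δ νH νG Sbad Δ mH mG) (hACS : ArchCanonicalSingularMatrix L H' Tinf νGi νqi νHi hanis m' m mHi t' t tH), ∀ (γ₀ :
        (UnitaryGroup.cmDatum L 3 H').Rational) (e₁ e₂ : L), e₁ ≠ e₂ → ((((γ₀ : unitaryGroup (cmConjRingHom L) H').val : GL (Fin 3) L) : Matrix (Fin 3) (Fin 3) L) - e₁ • (1 : Matrix (Fin 3) (Fin 3) L)) * ((((γ₀ : unitaryGroup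
        (cmConjRingHom L) H').val : GL (Fin 3) L) : Matrix (Fin 3) (Fin 3) L) - e₂ • (1 : Matrix (Fin 3) (Fin 3) L)) = 0 → (¬ ∃ ζ : L, (((γ₀ : unitaryGroup (cmConjRingHom L) H').val : GL (Fin 3) L) : Matrix (Fin 3) (Fin 3) L) = ζ • (1
        : Matrix (Fin 3) (Fin 3) L)) → (((γ₀ : unitaryGroup (cmConjRingHom L) H').val : GL (Fin 3) L) : Matrix (Fin 3) (Fin 3) L).charpoly = (Polynomial.X - Polynomial.C e₁) ^ 2 * (Polynomial.X - Polynomial.C e₂) → ∀ (γH :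
        (UnitaryGroup.cmDatum L 2 (Matrix.of fun i j : Fin 2 => if i.val + j.val + 1 = 2 then (1 : L) else 0)).Rational × (UnitaryGroup.cmDatum L 1 (Matrix.of fun i j : Fin 1 => if i.val + j.val + 1 = 1 then (1 : L) else 0)).Rational),
        (((γH.1 : unitaryGroup (cmConjRingHom L) (Matrix.of fun i j : Fin 2 => if i.val + j.val + 1 = 2 then (1 : L) else 0)).val : GL (Fin 2) L) : Matrix (Fin 2) (Fin 2) L) = e₁ • (1 : Matrix (Fin 2) (Fin 2) L) → (((γH.2 :
        unitaryGroup (cmConjRingHom L) (Matrix.of fun i j : Fin 1 => if i.val + j.val + 1 = 1 then (1 : L) else 0)).val : GL (Fin 1) L) : Matrix (Fin 1) (Fin 1) L) 0 0 = e₂ → ∀ (v : HeightOneSpectrum (𝓞 ↥(maximalRealSubfield L))), ∃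
        (fH : (UnitaryGroup.cmDatum L 2 (Matrix.of fun i j : Fin 2 => if i.val + j.val + 1 = 2 then (1 : L) else 0)).Local v × (UnitaryGroup.cmDatum L 1 (Matrix.of fun i j : Fin 1 => if i.val + j.val + 1 = 1 then (1 : L) else 0)).Local
        v → ℂ) (f : (UnitaryGroup.cmDatum L 3 H').Local v → ℂ), IsLocSmooth f ∧ IsLocSmooth fH ∧ IsLocalDeltaTransfer L H' v (Δ v) (mH v) (mG v) fH f ∧ fH ((UnitaryGroup.cmDatum L 2 (Matrix.of fun i j : Fin 2 => if i.val + j.val + 1 =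
        2 then (1 : L) else 0)).toLocal v ((UnitaryGroup.cmDatum L 2 (Matrix.of fun i j : Fin 2 => if i.val + j.val + 1 = 2 then (1 : L) else 0)).toAdelic γH.1), (UnitaryGroup.cmDatum L 1 (Matrix.of fun i j : Fin 1 => if i.val + j.val
        + 1 = 1 then (1 : L) else 0)).toLocal v ((UnitaryGroup.cmDatum L 1 (Matrix.of fun i j : Fin 1 => if i.val + j.val + 1 = 1 then (1 : L) else 0)).toAdelic γH.2)) ≠ 0) :
        ∀ (hK : ∀ v : HeightOneSpectrum (𝓞 ↥(maximalRealSubfield L)), νG v (UnitaryGroup.cmLocalIntegralLevel L 3 H' v : Set ((UnitaryGroup.cmDatum L 3 H').Local v)) = 1)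
          (hanis : ∀ x : Fin 3 → L, hermForm (cmConjRingHom L) H' x x = 0 → x = 0)
          (Sbad : Finset (HeightOneSpectrum (𝓞 ↥(maximalRealSubfield L))))
              (Δ : ∀ v : HeightOneSpectrum (𝓞 ↥(maximalRealSubfield L)), LocalTransferFactor L H' v)
              (mH : ∀ v : HeightOneSpectrum (𝓞 ↥(maximalRealSubfield L)),
                OrbitalMeasureFamily ((UnitaryGroup.cmDatum L 2 (Matrix.of fun i j : Fin 2 => if i.val + j.val + 1 = 2 then (1 : L) else 0)).Local v ×
                  (UnitaryGroup.cmDatum L 1 (Matrix.of fun i j : Fin 1 => if i.val + j.val + 1 = 1 then (1 : L) else 0)).Local v))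
              (mG : ∀ v : HeightOneSpectrum (𝓞 ↥(maximalRealSubfield L)), OrbitalMeasureFamily ((UnitaryGroup.cmDatum L 3 H').Local v))
          (m' : OrbitalMeasureFamily (UnitaryGroup.arch (↥(maximalRealSubfield L)) L (IsCMField.complexConj L) 3 H'))
                (m : OrbitalMeasureFamily (UnitaryGroup.arch (↥(maximalRealSubfield L)) L (IsCMField.complexConj L) 3
                  (Matrix.of fun i j : Fin 3 => if i.val + j.val + 1 = 3 then (1 : L) else 0)))
                (mHi : OrbitalMeasureFamily (UnitaryGroup.arch (↥(maximalRealSubfield L)) L (IsCMField.complexConj L) 2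
                    (Matrix.of fun i j : Fin 2 => if i.val + j.val + 1 = 2 then (1 : L) else 0) ×
                  UnitaryGroup.arch (↥(maximalRealSubfield L)) L (IsCMField.complexConj L) 1
                    (Matrix.of fun i j : Fin 1 => if i.val + j.val + 1 = 1 then (1 : L) else 0)))
                (t' : ∀ γ' : UnitaryGroup.arch (↥(maximalRealSubfield L)) L (IsCMField.complexConj L) 3 H',
                  Measure (Subgroup.centralizer ({γ'} : Set (UnitaryGroup.arch (↥(maximalRealSubfield L)) L (IsCMField.complexConj L) 3 H'))))
                (t : ∀ γ : UnitaryGroup.arch (↥(maximalRealSubfield L)) L (IsCMField.complexConj L) 3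
                    (Matrix.of fun i j : Fin 3 => if i.val + j.val + 1 = 3 then (1 : L) else 0),
                  Measure (Subgroup.centralizer ({γ} : Set (UnitaryGroup.arch (↥(maximalRealSubfield L)) L (IsCMField.complexConj L) 3
                    (Matrix.of fun i j : Fin 3 => if i.val + j.val + 1 = 3 then (1 : L) else 0)))))
                (tH : ∀ γH : UnitaryGroup.arch (↥(maximalRealSubfield L)) L (IsCMField.complexConj L) 2
                      (Matrix.of fun i j : Fin 2 => if i.val + j.val + 1 = 2 then (1 : L) else 0) ×
                    UnitaryGroup.arch (↥(maximalRealSubfield L)) L (IsCMField.complexConj L) 1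
                      (Matrix.of fun i j : Fin 1 => if i.val + j.val + 1 = 1 then (1 : L) else 0),
                  Measure (Subgroup.centralizer ({γH} : Set (UnitaryGroup.arch (↥(maximalRealSubfield L)) L (IsCMField.complexConj L) 2
                      (Matrix.of fun i j : Fin 2 => if i.val + j.val + 1 = 2 then (1 : L) else 0) ×
                    UnitaryGroup.arch (↥(maximalRealSubfield L)) L (IsCMField.complexConj L) 1
                      (Matrix.of fun i j : Fin 1 => if i.val + j.val + 1 = 1 then (1 : L) else 0)))))
            (hherm : (H'.map (cmConjRingHom L)).transpose = H')
            (hCTM : CanonicalTransferMatrix L H' Tinf.Δ νH νG Sbad Δ mH mG)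
            (hACS : ArchCanonicalSingularMatrix L H' Tinf νGi νqi νHi hanis m' m mHi t' t tH),
    ∀ (μ : Literature.NumberTheory.GaloisRepresentations.HeckeCharacter L) (hμu : μ.IsUnitary)
      (hμω : ∀ x : Literature.NumberTheory.GaloisRepresentations.ideleGroup ↥(maximalRealSubfield L),
        μ (AdeleRing.ideleBaseChange (↥(maximalRealSubfield L)) L x) = quadraticHeckeCharCM L x)
      (hΔ : Δ = finExplicitCollection L H' μ (finExplicitDelta_conj_left_all L H' μ) (finExplicitDelta_conj_right_all L H' μ))
      (hTinf : Tinf = archCanonicalTransferFactor L H' μ),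
        ∀ (mGs₀ : ∀ v : HeightOneSpectrum (𝓞 ↥(maximalRealSubfield L)), OrbitalMeasureFamily ((UnitaryGroup.cmDatum L 3 H').Local v)),
          (∀ v, (mGs₀ v).IsQuotientOf (fun x : (UnitaryGroup.cmDatum L 3 H').Local v => ∃ γ₀ : (UnitaryGroup.cmDatum L 3 H').Rational, ¬ IsRegularElt (γ₀.val : GL (Fin 3) L) ∧
                Corresponds (UnitaryGroup.conjLocal L (IsCMField.complexConj L) v)
                  ((UnitaryGroup.adelicForm L 3 H').map (UnitaryGroup.adeleToLocal L v))
                  ((UnitaryGroup.adelicForm L 3 H').map (UnitaryGroup.adeleToLocal L v))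
                  ((UnitaryGroup.cmDatum L 3 H').toLocal v ((UnitaryGroup.cmDatum L 3 H').toAdelic γ₀)) x) (νG v) (Literature.NumberTheory.Weil1982.UnitaryFinTopForm.finTamagawaPartner L 3 H' v)) →
              ∀ (γ₀ : (UnitaryGroup.cmDatum L 3 H').Rational) (e₁ e₂ : L), e₁ ≠ e₂ →
                ((((γ₀ : unitaryGroup (cmConjRingHom L) H').val : GL (Fin 3) L) : Matrix (Fin 3) (Fin 3) L) - e₁ • (1 : Matrix (Fin 3) (Fin 3) L)) * ((((γ₀ : unitaryGroup (cmConjRingHom L) H').val : GL (Fin 3) L) : Matrix (Fin 3) (Fin 3) L) - e₂ • (1 : Matrix (Fin 3) (Fin 3) L)) = 0 →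
                (¬ ∃ ζ : L, (((γ₀ : unitaryGroup (cmConjRingHom L) H').val : GL (Fin 3) L) : Matrix (Fin 3) (Fin 3) L) = ζ • (1 : Matrix (Fin 3) (Fin 3) L)) →
                (((γ₀ : unitaryGroup (cmConjRingHom L) H').val : GL (Fin 3) L) : Matrix (Fin 3) (Fin 3) L).charpoly =
                  (Polynomial.X - Polynomial.C e₁) ^ 2 * (Polynomial.X - Polynomial.C e₂) →
                ∀ (γH : (UnitaryGroup.cmDatum L 2 (Matrix.of fun i j : Fin 2 => if i.val + j.val + 1 = 2 then (1 : L) else 0)).Rational ×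
                    (UnitaryGroup.cmDatum L 1 (Matrix.of fun i j : Fin 1 => if i.val + j.val + 1 = 1 then (1 : L) else 0)).Rational),
                  (((γH.1 : unitaryGroup (cmConjRingHom L) (Matrix.of fun i j : Fin 2 => if i.val + j.val + 1 = 2 then (1 : L) else 0)).val : GL (Fin 2) L) : Matrix (Fin 2) (Fin 2) L) =
                    e₁ • (1 : Matrix (Fin 2) (Fin 2) L) →
                  (((γH.2 : unitaryGroup (cmConjRingHom L) (Matrix.of fun i j : Fin 1 => if i.val + j.val + 1 = 1 then (1 : L) else 0)).val : GL (Fin 1) L) : Matrix (Fin 1) (Fin 1) L) 0 0 = e₂ →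
                  ∀ (v : HeightOneSpectrum (𝓞 ↥(maximalRealSubfield L))), ¬ Subsingleton (UnitaryGroup.PlacesOver L v) →
                    ∃ cv : ℂ, cv ≠ 0 ∧ ∀
                          (fH : (UnitaryGroup.cmDatum L 2 (Matrix.of fun i j : Fin 2 => if i.val + j.val + 1 = 2 then (1 : L) else 0)).Local v × (UnitaryGroup.cmDatum L 1 (Matrix.of fun i j : Fin 1 => if i.val + j.val + 1 = 1 then (1 : L) else 0)).Local v → ℂ) (f : (UnitaryGroup.cmDatum L 3 H').Local v → ℂ),
                        IsLocSmooth f → IsLocSmooth fH → IsLocalDeltaTransfer L H' v (Δ v) (mH v) (mG v) fH f →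
                        localStableOrbitalIntegral L 3 H' v (mGs₀ v) f ((UnitaryGroup.cmDatum L 3 H').toLocal v ((UnitaryGroup.cmDatum L 3 H').toAdelic γ₀)) =
                          cv * fH ((UnitaryGroup.cmDatum L 2 (Matrix.of fun i j : Fin 2 => if i.val + j.val + 1 = 2 then (1 : L) else 0)).toLocal v ((UnitaryGroup.cmDatum L 2 (Matrix.of fun i j : Fin 2 => if i.val + j.val + 1 = 2 then (1 : L) else 0)).toAdelic γH.1),
                            (UnitaryGroup.cmDatum L 1 (Matrix.of fun i j : Fin 1 => if i.val + j.val + 1 = 1 then (1 : L) else 0)).toLocal v ((UnitaryGroup.cmDatum L 1 (Matrix.of fun i j : Fin 1 => if i.val + j.val + 1 = 1 then (1 : L) else 0)).toAdelic γH.2)) := by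
  intro hK hanis Sbad Δ mH mG m' m mHi t' t tH hherm hCTM hACS μ hμu hμω hΔ hTinf mGs₀ hquot γ₀ e₁ e₂ hne hprod hnsc hchar γH hγH1 hγH2 v _hsplit
  -- the frame data read by the deduction
  have hdet : H'.det ≠ 0 := det_ne_zero_of_anisotropic hanis
  have hmHadm : (mH v).IsAdmissibleOn (IsLocalGRegular L v) := (hCTM.1 v).1.2.1
  have hmGadm : (mG v).IsAdmissibleOn (fun γ => IsRegularElt (γ.val : GL (Fin 3) (UnitaryGroup.LocalRing L v))) := (hCTM.1 v).1.2.2.1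
  -- the singular point `(γ₀)_v` is killed by `(X − e₁)(X − e₂)`, `e₁ − e₂` a unit of `L ⊗ L⁺_v`
  have hab : IsUnit (algebraMap L (UnitaryGroup.LocalRing L v) e₁ - algebraMap L (UnitaryGroup.LocalRing L v) e₂) := isUnit_algebraMap_localRing_sub v hne
  have hγv := mul_sub_smul_toLocal_toAdelic_eq_zero v γ₀ hprod
  have hnreg : ¬ IsRegularElt (γ₀.val : GL (Fin 3) L) := not_isRegularElt_of_charpoly_eq _ e₁ e₂ hchar
  -- members of `mGs₀ v` on the stable class of `(γ₀)_v` are finite on compacta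
  have hfin : ∀ c : ConjClasses ((UnitaryGroup.cmDatum L 3 H').Local v),
      IsStablyConj (UnitaryGroup.conjLocal L (IsCMField.complexConj L) v) ((UnitaryGroup.adelicForm L 3 H').map (UnitaryGroup.adeleToLocal L v))
        ((UnitaryGroup.cmDatum L 3 H').toLocal v ((UnitaryGroup.cmDatum L 3 H').toAdelic γ₀)) (Quotient.out c) → IsFiniteMeasureOnCompacts ((mGs₀ v) c) := by
    intro c hc
    exact ((hquot v).isAdmissibleOn c ⟨γ₀, hnreg, hc⟩).2.2
  -- kernel inclusion (#5) and the witness (#7) at `v`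
  have hker := h5 hK hanis Sbad Δ mH mG m' m mHi t' t tH hherm hCTM hACS μ hμu hμω hΔ hTinf mGs₀ hquot γ₀ e₁ e₂ hne hprod hnsc hchar γH hγH1 hγH2 v
  obtain ⟨fH₀, f₀, hf₀, hfH₀, htr₀, hne₀⟩ := h7 hK hanis Sbad Δ mH mG m' m mHi t' t tH hherm hCTM hACS γ₀ e₁ e₂ hne hprod hnsc hchar γH hγH1 hγH2 v
  -- the linear algebra (§1), in the socket's curried shape
  refine Exists.imp (fun c hc => ⟨hc.1, fun fH f hf hfH htr => hc.2 fH f ⟨hf, hfH, htr⟩⟩)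
    (exists_ne_zero_forall_eq_mul_of_kernel_subset
    (fun (fH : (UnitaryGroup.cmDatum L 2 (Matrix.of fun i j : Fin 2 => if i.val + j.val + 1 = 2 then (1 : L) else 0)).Local v × (UnitaryGroup.cmDatum L 1 (Matrix.of fun i j : Fin 1 => if i.val + j.val + 1 = 1 then (1 : L) else 0)).Local v → ℂ) (f : (UnitaryGroup.cmDatum L 3 H').Local v → ℂ) =>
      IsLocSmooth f ∧ IsLocSmooth fH ∧ IsLocalDeltaTransfer L H' v (Δ v) (mH v) (mG v) fH f)
    (fun f => localStableOrbitalIntegral L 3 H' v (mGs₀ v) f ((UnitaryGroup.cmDatum L 3 H').toLocal v ((UnitaryGroup.cmDatum L 3 H').toAdelic γ₀)))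
    (fun fH => fH ((UnitaryGroup.cmDatum L 2 (Matrix.of fun i j : Fin 2 => if i.val + j.val + 1 = 2 then (1 : L) else 0)).toLocal v ((UnitaryGroup.cmDatum L 2 (Matrix.of fun i j : Fin 2 => if i.val + j.val + 1 = 2 then (1 : L) else 0)).toAdelic γH.1), (UnitaryGroup.cmDatum L 1 (Matrix.of fun i j : Fin 1 => if i.val + j.val + 1 = 1 then (1 : L) else 0)).toLocal v ((UnitaryGroup.cmDatum L 1 (Matrix.of fun i j : Fin 1 => if i.val + j.val + 1 = 1 then (1 : L) else 0)).toAdelic γH.2)))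
    ?_ ?_ ?_ ?_ ?_)
  · -- closure of the transfer pairs under `(p, q, a) ↦ p − a • q`
    rintro fH gH f g a ⟨hf, hfH, htr⟩ ⟨hg, hgH, htr'⟩
    refine ⟨isLocSmooth_sub_const_smul a hf hg, isLocSmooth_sub_const_smul a hfH hgH, ?_⟩
    have hsg := isLocSmooth_const_smul (-a) hg
    have hsgH := isLocSmooth_const_smul (-a) hgH
    have hadd := IsLocalDeltaTransfer.add L H' v hherm hdet hmHadm hmGadm hfH.continuous hfH.hasCompactSupport hsgH.continuous hsgH.hasCompactSupport
      hf.continuous hf.hasCompactSupport hsg.continuous hsg.hasCompactSupport htr (IsLocalDeltaTransfer.smul_fun L H' v htr' (-a))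
    rw [neg_smul, neg_smul, ← sub_eq_add_neg, ← sub_eq_add_neg] at hadd
    exact hadd
  · -- linearity of `Φ^st(γ_{0,v}, ·; mGs₀ v)` on `C_c`
    rintro fH gH f g a ⟨hf, -, -⟩ ⟨hg, -, -⟩
    have hsg := isLocSmooth_const_smul (-a) hg
    have hadd := localStableOrbitalIntegral_add_of_mul_sub_smul_eq_zero L 3 H' v hherm hdet _ hab hγv hfin hf.continuous hf.hasCompactSupport
      hsg.continuous hsg.hasCompactSupport
    have hsmul : localStableOrbitalIntegral L 3 H' v (mGs₀ v) ((-a) • g) ((UnitaryGroup.cmDatum L 3 H').toLocal v ((UnitaryGroup.cmDatum L 3 H').toAdelic γ₀)) =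
        (-a) * localStableOrbitalIntegral L 3 H' v (mGs₀ v) g ((UnitaryGroup.cmDatum L 3 H').toLocal v ((UnitaryGroup.cmDatum L 3 H').toAdelic γ₀)) :=
      stableOrbitalIntegralRel_smul_fun _ (mGs₀ v) (-a) g _
    show localStableOrbitalIntegral L 3 H' v (mGs₀ v) (f - a • g) _ = localStableOrbitalIntegral L 3 H' v (mGs₀ v) f _ - a * localStableOrbitalIntegral L 3 H' v (mGs₀ v) g _
    rw [sub_eq_add_neg, ← neg_smul, hadd, hsmul, neg_mul, ← sub_eq_add_neg]
  · -- evaluation is linear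
    intro fH gH a
    simp only [Pi.sub_apply, Pi.smul_apply, smul_eq_mul]
  · rintro fH f ⟨hf, hfH, htr⟩ h0
    exact hker fH f hf hfH htr h0
  · exact ⟨fH₀, f₀, ⟨hf₀, hfH₀, htr₀⟩, hne₀⟩

end Frame

end Summit.HodgeConjecture.HodgeConjecture.Cruxes.H413.K2E4ExplicitSplitSingularTransferOfGermSockets

end
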